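import Mathlib.Analysis.SpecialFunctions.Pow.Asymptotics
import Mathlib.Analysis.SpecialFunctions.Log.Base
import Mathlib.Analysis.Complex.ExponentialBounds
import Literature.Computability.Complexity.AverageCaseDepthHierarchy
import HarnessLib

/-!
# Parameter asymptotics for "`PH` is infinite relative to a random oracle" (RST 2015, Thm. 2)

Real-analysis bookkeeping isolating every use of the two named facts of
`AverageCaseDepthHierarchy.lean` — Rossman–Servedio–Tan 2015 (arXiv:1504.03398
[RossmanServedioTan2015]) **Thm. 1** in its corrected transcription
`rossmanServedioTan2015_thm1_inRegime` (the average-case depth hierarchy theorem, with its range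
hypothesis `2 ≤ d ≤ c √(log n)/log log n`, the regime hypothesis `d ≤ c m / log₂ m` of Lemma 7.1
under which the printed proof runs, size bound `2^{n^{1/(6(d-1))}}` and correlation bound
`1/2 + n^{-C/d}`; see the design note "Circularity of the printed range" in
`AverageCaseDepthHierarchy.lean`) and the top fan-in estimate **`w₀ = 2^m ln 2 (1 ± o(1))`**
(`rossmanServedioTan2015_w0_asymp`, §6 p. 15 with Lemma 7.1, in the regime `d ≤ c m / log m`;
PROVED in `AverageCaseDepthHierarchyProofs.lean`) — from the combinatorial diagonalization that
derives Thm. 2 (`RandomOraclePHProofs.lean`). For FIXED depth `D ≥ 2` and `m → ∞` both the range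
and the regime hypotheses are eventually automatic:

* `exists_nat_ge_le_mul_div_logb` (`m / log₂ m → ∞`), `exists_real_ge_le_mul_sqrt_div_logb`
  (`√L / log₂ L → ∞`), `exists_nat_ge_polylog_le_rpow` (`C (a log₂ n + b)^k + C ≤ n^ε`
  eventually), `exists_nat_ge_rpow_neg_le` (`n^{-y} ≤ δ` eventually) — the four elementary
  eventualities, from Mathlib's `Real.isLittleO_log_id_atTop`, `isLittleO_log_rpow_atTop`,
  `isLittleO_log_rpow_rpow_atTop`, `tendsto_rpow_neg_atTop`;
* `rst_regime` — from the `w₀` estimate: for `m` large, `m, w, w₀ ≥ 1`, `w₀ ≥ 2^m/4`, hence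
  `n = rstN m D ≥ 2^m/4` and `m ≤ log₂ n + 2`;
* `rst_thm1_regime_of_inRegime` — **Thm. 1 in the form the diagonalization consumes**: for
  every `D ≥ 2` and every polylogarithmic size exponent `c₂ (a log₂ n + b)^k + c₂`, for all large
  `m`, every `acBasis` circuit of `acDepth ≤ D - 1` and at most `2^{c₂ (a log₂ n + b)^k + c₂}`
  gates on the leaves of `Sipser_D` agrees with `balancedSipser m D` on at most `(3/5) · 2ⁿ` leaf
  assignments (the regime and range hypotheses hold, the size is below `2^{n^{1/(6(D-1))}}`, and
  `n^{-C/D} ≤ 1/10`). (The literal transcription `rossmanServedioTan2015_thm1` implies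
  `_inRegime`, `rossmanServedioTan2015_thm1_inRegime_of_thm1`, so it yields the same conclusion;
  no file consumes it any more.)

Everything here is proved (conditionally on the named facts where they appear as hypotheses);
nothing is specific to oracles.

## References

* [RossmanServedioTan2015] arXiv:1504.03398, Thm. 1 (p. 3), §6 (p. 15), Lemma 7.1 (p. 16).
-/

noncomputable section

namespace Literature.Computability.Complexity

open Filter Asymptotics Finset

/-! ### Four elementary eventualities -/

/-- `m / log₂ m → ∞`: for `D, c > 0`, eventually `D ≤ c m / log₂ m`. [folklore] -/
theorem exists_nat_ge_le_mul_div_logb {D c : ℝ} (hD : 0 < D) (hc : 0 < c) :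
    ∃ m₁ : ℕ, ∀ m : ℕ, m₁ ≤ m → D ≤ c * m / Real.logb 2 m := by
  have hlog2 : 0 < Real.log 2 := Real.log_pos one_lt_two
  have hε : 0 < c * Real.log 2 / D := by positivity
  obtain ⟨a, ha⟩ := eventually_atTop.1 (Real.isLittleO_log_id_atTop.def hε)
  refine ⟨max 2 ⌈a⌉₊, fun m hm => ?_⟩
  have hm2 : (2 : ℝ) ≤ m := by exact_mod_cast (le_max_left _ _).trans hm
  have hma : a ≤ m := (Nat.le_ceil a).trans (by exact_mod_cast (le_max_right _ _).trans hm)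
  have h := ha m hma
  rw [id, Real.norm_eq_abs, Real.norm_eq_abs, abs_of_nonneg (Real.log_nonneg (by linarith)),
    abs_of_nonneg (by linarith)] at h
  have hlogb : 0 < Real.logb 2 m := Real.logb_pos one_lt_two (by linarith)
  rw [le_div_iff₀ hlogb, Real.logb, mul_div_assoc', div_le_iff₀ hlog2]
  calc D * Real.log m ≤ D * (c * Real.log 2 / D * m) := mul_le_mul_of_nonneg_left h hD.le
    _ = c * m * Real.log 2 := by field_simp

/-- `√L / log₂ L → ∞`: for `D, c > 0`, eventually `D ≤ c √L / log₂ L`. [folklore] -/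
theorem exists_real_ge_le_mul_sqrt_div_logb {D c : ℝ} (hD : 0 < D) (hc : 0 < c) :
    ∃ L₀ : ℝ, ∀ L : ℝ, L₀ ≤ L → D ≤ c * Real.sqrt L / Real.logb 2 L := by
  have hlog2 : 0 < Real.log 2 := Real.log_pos one_lt_two
  have hε : 0 < c * Real.log 2 / D := by positivity
  obtain ⟨a, ha⟩ := eventually_atTop.1
    ((isLittleO_log_rpow_atTop (by norm_num : (0 : ℝ) < 1 / 2)).def hε)
  refine ⟨max 2 a, fun L hL => ?_⟩
  have hL2 : 2 ≤ L := (le_max_left _ _).trans hL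
  have h := ha L ((le_max_right _ _).trans hL)
  rw [Real.norm_eq_abs, Real.norm_eq_abs, abs_of_nonneg (Real.log_nonneg (by linarith)),
    abs_of_nonneg (Real.rpow_nonneg (by linarith) _)] at h
  have hlogb : 0 < Real.logb 2 L := Real.logb_pos one_lt_two (by linarith)
  rw [le_div_iff₀ hlogb, Real.sqrt_eq_rpow, Real.logb, mul_div_assoc', div_le_iff₀ hlog2]
  calc D * Real.log L ≤ D * (c * Real.log 2 / D * L ^ (1 / 2 : ℝ)) :=
        mul_le_mul_of_nonneg_left h hD.le
    _ = c * L ^ (1 / 2 : ℝ) * Real.log 2 := by field_simp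

/-- `1/2 ≤ ln 2` (from `1 - 1/x ≤ log x`). [folklore] -/
theorem half_le_log_two : (1 : ℝ) / 2 ≤ Real.log 2 := by
  have := Real.one_sub_inv_le_log_of_pos (show (0 : ℝ) < 2 by norm_num)
  linarith

/-- `log₂ n ≤ 2 ln n` for naturals `n ≥ 1` (integer logarithm against natural logarithm). [folklore] -/
theorem natLog_two_le_two_mul_log {n : ℕ} (hn : 1 ≤ n) : (Nat.log 2 n : ℝ) ≤ 2 * Real.log n := by
  have hn' : (1 : ℝ) ≤ n := by exact_mod_cast hn
  have h1 : (Nat.log 2 n : ℝ) ≤ Real.logb 2 n := by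
    rw [← Real.natFloor_logb_natCast 2 n]
    exact Nat.floor_le (Real.logb_nonneg one_lt_two hn')
  have h2 : Real.logb 2 n ≤ 2 * Real.log n := by
    rw [Real.logb, div_le_iff₀ (Real.log_pos one_lt_two)]
    have := half_le_log_two
    have hlogn : 0 ≤ Real.log n := Real.log_nonneg hn'
    nlinarith
  exact h1.trans h2

/-- **Polylogarithms are eventually below every power**: for `ε > 0`,
`C (a log₂ n + b)^k + C ≤ n^ε` for all large `n`. [folklore] -/
theorem exists_nat_ge_polylog_le_rpow (C k a b : ℕ) {ε : ℝ} (hε : 0 < ε) :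
    ∃ N₀ : ℕ, ∀ n : ℕ, N₀ ≤ n → (C * (a * Nat.log 2 n + b) ^ k + C : ℝ) ≤ (n : ℝ) ^ ε := by
  set K : ℝ := C * (2 * a + b) ^ k + C + 1 with hK
  have hKpos : 0 < K := by positivity
  obtain ⟨x₀, hx₀⟩ := eventually_atTop.1
    ((isLittleO_log_rpow_rpow_atTop (k : ℝ) hε).def (show (0 : ℝ) < 1 / K by positivity))
  refine ⟨max 3 ⌈x₀⌉₊, fun n hn => ?_⟩
  have hn3 : (3 : ℝ) ≤ n := by exact_mod_cast (le_max_left _ _).trans hn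
  have hn1 : 1 ≤ n := le_trans (by norm_num) ((le_max_left _ _).trans hn)
  have hnx : x₀ ≤ n := (Nat.le_ceil x₀).trans (by exact_mod_cast (le_max_right _ _).trans hn)
  -- `log n ≥ 1`
  have hlog1 : 1 ≤ Real.log n := by
    rw [Real.le_log_iff_exp_le (by linarith)]
    have := Real.exp_one_lt_three
    linarith
  have hlog0 : 0 ≤ Real.log n := by linarith
  -- the polylogarithm is at most `K (log n)^k`
  have hbase : (a * Nat.log 2 n + b : ℝ) ≤ (2 * a + b) * Real.log n := by
    have h1 := natLog_two_le_two_mul_log hn1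
    have ha : (0 : ℝ) ≤ a := Nat.cast_nonneg a
    have hb : (0 : ℝ) ≤ b := Nat.cast_nonneg b
    nlinarith
  have hpow : (a * Nat.log 2 n + b : ℝ) ^ k ≤ (2 * a + b) ^ k * Real.log n ^ k := by
    rw [← mul_pow]
    exact pow_le_pow_left₀ (by positivity) hbase k
  have hlogk : 1 ≤ Real.log n ^ k := one_le_pow₀ hlog1
  have hpoly : (C * (a * Nat.log 2 n + b) ^ k + C : ℝ) ≤ K * Real.log n ^ k := by
    have hC : (0 : ℝ) ≤ C := Nat.cast_nonneg C
    calc (C * (a * Nat.log 2 n + b) ^ k + C : ℝ)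
        ≤ C * ((2 * a + b) ^ k * Real.log n ^ k) + C * Real.log n ^ k := by
          gcongr
          · simpa using mul_le_mul_of_nonneg_left hlogk hC
      _ = (C * (2 * a + b) ^ k + C) * Real.log n ^ k := by ring
      _ ≤ K * Real.log n ^ k := by
          refine mul_le_mul_of_nonneg_right ?_ (by positivity)
          rw [hK]; linarith
  -- `(log n)^k ≤ n^ε / K`
  have h := hx₀ n hnx
  rw [Real.norm_eq_abs, Real.norm_eq_abs, Real.rpow_natCast, abs_of_nonneg (by positivity),
    abs_of_nonneg (Real.rpow_nonneg (by linarith) _)] at h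
  calc (C * (a * Nat.log 2 n + b) ^ k + C : ℝ) ≤ K * Real.log n ^ k := hpoly
    _ ≤ K * (1 / K * (n : ℝ) ^ ε) := mul_le_mul_of_nonneg_left h hKpos.le
    _ = (n : ℝ) ^ ε := by field_simp

/-- Negative powers are eventually small: for `y, δ > 0`, `n^{-y} ≤ δ` for all large `n`. [folklore] -/
theorem exists_nat_ge_rpow_neg_le {y : ℝ} (hy : 0 < y) {δ : ℝ} (hδ : 0 < δ) :
    ∃ N₁ : ℕ, ∀ n : ℕ, N₁ ≤ n → (n : ℝ) ^ (-y) ≤ δ := by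
  obtain ⟨a, ha⟩ := eventually_atTop.1 ((tendsto_rpow_neg_atTop hy).eventually (Iic_mem_nhds hδ))
  exact ⟨⌈a⌉₊, fun n hn => ha n ((Nat.le_ceil a).trans (by exact_mod_cast hn))⟩

/-! ### The RST regime from the `w₀` estimate -/

/-- **The regime of RST's parameters for fixed depth**, from the printed estimate
`w₀ = 2^m ln 2 (1 ± o(1))` (`rossmanServedioTan2015_w0_asymp`): for `D ≥ 2` and all large `m`,
`m, w, w₀ ≥ 1`, `w₀ ≥ 2^m/4`, `n = rstN m D ≥ 2^m / 4`, and `m ≤ log₂ n + 2`.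
[cite: RossmanServedioTan2015, §6 (p. 15, w₀ estimate)] -/
theorem rst_regime (h0 : rossmanServedioTan2015_w0_asymp) {D : ℕ} (hD : 2 ≤ D) :
    ∃ m₁ : ℕ, ∀ m : ℕ, m₁ ≤ m →
      1 ≤ m ∧ 1 ≤ rstW m ∧ 1 ≤ rstW0 m D ∧ (2 : ℝ) ^ m / 4 ≤ rstW0 m D ∧
      (2 : ℝ) ^ m / 4 ≤ rstN m D ∧ m ≤ Nat.log 2 (rstN m D) + 2 := by
  obtain ⟨c, hc, hw0⟩ := h0
  obtain ⟨m₀, hm₀⟩ := hw0 (1 / 2) (by norm_num)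
  obtain ⟨m₁, hm₁⟩ := exists_nat_ge_le_mul_div_logb (show (0 : ℝ) < D by positivity) hc
  refine ⟨max (max m₀ m₁) 2, fun m hm => ?_⟩
  have hm0 : m₀ ≤ m := ((le_max_left _ _).trans (le_max_left _ _)).trans hm
  have hm1 : m₁ ≤ m := ((le_max_right _ _).trans (le_max_left _ _)).trans hm
  have hm2 : 2 ≤ m := (le_max_right _ _).trans hm
  have hlog2 := half_le_log_two
  have hlog2' : Real.log 2 ≤ 1 := by
    have := Real.log_le_sub_one_of_pos (show (0 : ℝ) < 2 by norm_num); linarith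
  have hpow4 : (4 : ℝ) ≤ 2 ^ m := by
    calc (4 : ℝ) = 2 ^ 2 := by norm_num
      _ ≤ 2 ^ m := pow_le_pow_right₀ (by norm_num) hm2
  -- `w₀ ≥ 2^m ln 2 / 2 ≥ 2^m / 4`
  have hreg := hm₀ m hm0 D hD (hm₁ m hm1)
  have hpos : 0 < (2 : ℝ) ^ m * Real.log 2 := by positivity
  have hw0low : (2 : ℝ) ^ m / 4 ≤ rstW0 m D := by
    have h1 := (abs_le.1 hreg).1
    have h2 : (1 : ℝ) / 2 ≤ (rstW0 m D : ℝ) / (2 ^ m * Real.log 2) := by linarith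
    rw [le_div_iff₀ hpos] at h2
    have h3 : (2 : ℝ) ^ m / 4 ≤ 1 / 2 * (2 ^ m * Real.log 2) := by nlinarith [pow_pos (show (0:ℝ) < 2 by norm_num) m]
    exact h3.trans h2
  have hw0one : 1 ≤ rstW0 m D := by
    have : (1 : ℝ) ≤ rstW0 m D := le_trans (by linarith) hw0low
    exact_mod_cast this
  -- `w ≥ 1`
  have hW : 1 ≤ rstW m := by
    refine Nat.le_floor ?_
    have hm2' : (2 : ℝ) ≤ m := by exact_mod_cast hm2
    calc ((1 : ℕ) : ℝ) = 1 := by norm_num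
      _ ≤ (m : ℝ) * 2 ^ m * Real.log 2 := by nlinarith
  -- `n ≥ w₀`
  have hN : (rstW0 m D : ℝ) ≤ rstN m D := by
    rw [rstN_eq]
    push_cast
    have h1 : (1 : ℝ) ≤ (rstW m : ℝ) ^ (D - 2) := one_le_pow₀ (by exact_mod_cast hW)
    have h2 : (1 : ℝ) ≤ m := by exact_mod_cast (le_trans (by norm_num) hm2 : 1 ≤ m)
    have h0' : (0 : ℝ) ≤ rstW0 m D := Nat.cast_nonneg _
    calc (rstW0 m D : ℝ) = rstW0 m D * 1 * 1 := by ring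
      _ ≤ rstW0 m D * (rstW m : ℝ) ^ (D - 2) * m := by gcongr
  have hNlow : (2 : ℝ) ^ m / 4 ≤ rstN m D := hw0low.trans hN
  -- `m ≤ log₂ n + 2`
  have hlog : m ≤ Nat.log 2 (rstN m D) + 2 := by
    have h4 : 2 ^ (m - 2) ≤ rstN m D := by
      have h : ((2 ^ (m - 2) : ℕ) : ℝ) ≤ rstN m D := by
        have : ((2 ^ (m - 2) : ℕ) : ℝ) = 2 ^ m / 4 := by
          conv_rhs => rw [show m = (m - 2) + 2 from (Nat.sub_add_cancel hm2).symm]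
          push_cast
          rw [pow_add]; ring
        rw [this]; exact hNlow
      exact_mod_cast h
    have := Nat.le_log_of_pow_le one_lt_two h4
    omega
  exact ⟨le_trans (by norm_num) hm2, hW, hw0one, hw0low, hNlow, hlog⟩

/-! ### Theorem 1 in the form the diagonalization consumes -/

/-- **RST Thm. 1 for fixed depth and polylogarithmic size exponents**, from the corrected
transcription `rossmanServedioTan2015_thm1_inRegime` (Thm. 1 with the regime `d ≤ c m / log₂ m`
of Lemma 7.1) and `rossmanServedioTan2015_w0_asymp`: for every `D ≥ 2` and every `c₂, k, a, b`,
for all large `m` (where also `m, w, w₀ ≥ 1` and `m ≤ log₂ n + 2`, `n = rstN m D`), every circuit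
over `acBasis` of `acDepth ≤ D - 1` and at most `2^{c₂ (a log₂ n + b)^k + c₂}` gates on the leaves
of `Sipser_D` agrees with `balancedSipser m D` on at most `(3/5) · 2ⁿ` of the `2ⁿ` leaf
assignments. (Regime hypothesis: `m / log₂ m → ∞`; range hypothesis: `√(log n)/log log n → ∞`;
size: polylog `≤ n^{1/(6(D-1))}`; correlation: `n^{-C/D} ≤ 1/10`.)
[cite: RossmanServedioTan2015, Thm. 1 (p. 3) with §6 (p. 15) and Lemma 7.1 (p. 16)] -/
theorem rst_thm1_regime_of_inRegime (h1 : rossmanServedioTan2015_thm1_inRegime)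
    (h0 : rossmanServedioTan2015_w0_asymp) {D : ℕ} (hD : 2 ≤ D) (c₂ k a b : ℕ) :
    ∃ m₁ : ℕ, ∀ m : ℕ, m₁ ≤ m →
      (1 ≤ m ∧ 1 ≤ rstW m ∧ 1 ≤ rstW0 m D ∧ m ≤ Nat.log 2 (rstN m D) + 2) ∧
      ∀ F : Circuit (Addr (rstFanins m D)), F.IsOver acBasis → F.acDepth ≤ D - 1 →
        F.size ≤ 2 ^ (c₂ * (a * Nat.log 2 (rstN m D) + b) ^ k + c₂) →
        (((univ : Finset (Addr (rstFanins m D) → Bool)).filter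
            fun x => F.eval x = balancedSipser m D x).card : ℝ) ≤ 3 / 5 * 2 ^ rstN m D := by
  obtain ⟨c₁, hc₁, C, hC, m₀, hthm⟩ := h1
  obtain ⟨mr, hmr⟩ := rst_regime h0 hD
  have hDpos : (0 : ℝ) < D := by positivity
  -- the regime hypothesis of Lemma 7.1, eventually in `m`
  obtain ⟨mg, hmg⟩ := exists_nat_ge_le_mul_div_logb hDpos hc₁
  obtain ⟨L₀, hL₀⟩ := exists_real_ge_le_mul_sqrt_div_logb hDpos hc₁
  have hD1 : (1 : ℝ) ≤ (D : ℝ) - 1 := by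
    have : (2 : ℝ) ≤ D := by exact_mod_cast hD
    linarith
  have hε : 0 < 1 / (6 * ((D : ℝ) - 1)) := by positivity
  obtain ⟨N₀, hN₀⟩ := exists_nat_ge_polylog_le_rpow c₂ k a b hε
  obtain ⟨N₁, hN₁⟩ := exists_nat_ge_rpow_neg_le (show 0 < C / D by positivity)
    (show (0 : ℝ) < 1 / 10 by norm_num)
  -- threshold on `n`, converted into a threshold on `m` through `n ≥ 2^m / 4`
  set T : ℕ := max (max N₀ N₁) ⌈(2 : ℝ) ^ L₀⌉₊ with hT
  refine ⟨max (max m₀ mr) (max mg (4 * T).size), fun m hm => ?_⟩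
  have hmm₀ : m₀ ≤ m := ((le_max_left _ _).trans (le_max_left _ _)).trans hm
  have hmr' : mr ≤ m := ((le_max_right _ _).trans (le_max_left _ _)).trans hm
  have hmg' : mg ≤ m := ((le_max_left _ _).trans (le_max_right _ _)).trans hm
  have hms : (4 * T).size ≤ m := ((le_max_right _ _).trans (le_max_right _ _)).trans hm
  obtain ⟨hm1, hW, hW0, -, hNlow, hlog⟩ := hmr m hmr'
  set n : ℕ := rstN m D with hn
  -- `T < n`
  have hTn : T < n := by
    have h1 : 4 * T < 2 ^ m := (Nat.lt_size_self _).trans_le (Nat.pow_le_pow_right (by norm_num) hms)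
    have h2 : ((4 * T : ℕ) : ℝ) < 2 ^ m := by exact_mod_cast h1
    have h3 : (T : ℝ) < n := by push_cast at h2; linarith
    exact_mod_cast h3
  have hnN₀ : N₀ ≤ n := ((le_max_left _ _).trans (le_max_left _ _)).trans hTn.le
  have hnN₁ : N₁ ≤ n := ((le_max_right _ _).trans (le_max_left _ _)).trans hTn.le
  have hnL : (2 : ℝ) ^ L₀ ≤ n :=
    (Nat.le_ceil _).trans (by exact_mod_cast ((le_max_right _ _).trans hTn.le : ⌈(2 : ℝ) ^ L₀⌉₊ ≤ n))
  have hnpos : (0 : ℝ) < n := lt_of_lt_of_le (Real.rpow_pos_of_pos (by norm_num) _) hnL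
  refine ⟨⟨hm1, hW, hW0, hlog⟩, fun F hB hdep hsize => ?_⟩
  -- the range hypothesis of Thm. 1
  have hLn : L₀ ≤ Real.logb 2 n := by
    have := Real.logb_le_logb_of_le one_lt_two (Real.rpow_pos_of_pos (by norm_num) L₀) hnL
    rwa [Real.logb_rpow (by norm_num) (by norm_num)] at this
  have hrange := hL₀ (Real.logb 2 n) hLn
  -- the size hypothesis of Thm. 1
  have hsize' : (F.size : ℝ) ≤ (2 : ℝ) ^ ((n : ℝ) ^ (1 / (6 * ((D : ℝ) - 1)))) := by
    have h1 : (F.size : ℝ) ≤ (2 : ℝ) ^ ((c₂ * (a * Nat.log 2 n + b) ^ k + c₂ : ℕ) : ℝ) := by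
      rw [Real.rpow_natCast]
      exact_mod_cast hsize
    refine h1.trans (Real.rpow_le_rpow_of_exponent_le (by norm_num) ?_)
    push_cast
    exact hN₀ n hnN₀
  have hmain := hthm D m hD hmm₀ (hmg m hmg') hrange F hB hdep hsize'
  -- the correlation bound of Thm. 1 is at most `3/5`
  have hcorr : (n : ℝ) ^ (-C / (D : ℝ)) ≤ 1 / 10 := by
    rw [neg_div]; exact hN₁ n hnN₁
  have h2n : (0 : ℝ) < 2 ^ n := by positivity
  calc (((univ : Finset (Addr (rstFanins m D) → Bool)).filter
          fun x => F.eval x = balancedSipser m D x).card : ℝ)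
      ≤ (1 / 2 + (n : ℝ) ^ (-C / (D : ℝ))) * 2 ^ n := hmain
    _ ≤ (1 / 2 + 1 / 10) * 2 ^ n := by gcongr
    _ = 3 / 5 * 2 ^ n := by norm_num

end Literature.Computability.Complexity

end
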